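import Mathlib
import HarnessLib
import Summits.ResolutionOfSingularities.ResolutionOfSingularities.Theorems.WildQuotientsWildQuotientResolutionS1aLeafCanonical

/-!
# S1a — AGREEMENT OF WEIGHTED FILTRATIONS FROM FINITELY MANY MEMBERSHIPS (any type)

[OURS · L1 W4.5c · lead-1 g10; FRAME-STATUS rev10 (F2)/(F4) — the agreement clause of `KillAgreeReach` / `exists_isPrincipalCentre_touch_of_certCover`
reduced to finitely many ring memberships, for frames of ANY type] — NOT statements of the manuscript; counted 0; AI-level work, weaker than expert review.
Crux stmt-ResolutionOfSingularities-17941 `CyclicQuotientFourfolds`, line `s1a-logminvertex` v10, K-side. Route-independent; pure algebra.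

* `prod_pow_mem_weightedFiltration` — if `f' i ∈ 𝒥_{w' i}(f, w)` for all `i` then every monomial `f'^α` lies in `𝒥_{weight w' α}(f, w)`;
* ★ `weightedFiltration_le_of_mem` — hence `𝒥ₙ(f', w') ≤ 𝒥ₙ(f, w)` for all `n` (multiplicativity of the target filtration);
* ★★ `weightedFiltration_eq_of_mem_of_mem` — **MUTUAL MEMBERSHIP ⇒ AGREEMENT**: `f' i ∈ 𝒥_{w' i}(f, w)` and `f i ∈ 𝒥_{w i}(f', w')` for all `i` ⇒
  `𝒥ₙ(f, w) = 𝒥ₙ(f', w')` for all `n`. For the (2,1) leaf this is `x₁' ∈ 𝒥₂`, `x₃' ∈ 𝒥₁` and symmetrically — the content of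
  `weightedFiltration_eq_of_leaf` (p638258) is exactly the membership `x₁' ∈ 𝒥₂` (`mem_weightedFiltration_two_iff_of_leaf`); for other kill types
  (Jordan chains, conormal type) the same two-line reduction applies once the memberships are known;
* `weightedFiltration_eq_of_leaf'` — the leaf agreement re-derived through mutual membership (sanity check of the reduction).
-/

set_option linter.dupNamespace false

noncomputable section

open Literature.AlgebraicGeometry.Resolution

namespace Summit.ResolutionOfSingularities.ResolutionOfSingularities.Theorems.WildQuotientResolution.S1.KillCert

universe u

variable {B : Type u} [CommRing B]

/-- If every `f' i` lies in `𝒥_{w' i}(f, w)`, then every monomial `f'^α` lies in `𝒥_{weight w' α}(f, w)`. [OURS · L1 W4.5c] -/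
theorem prod_pow_mem_weightedFiltration {c c' : ℕ} (f : Fin c → B) (w : Fin c → ℕ) (f' : Fin c' → B) (w' : Fin c' → ℕ)
    (hmem : ∀ i, f' i ∈ (weightedFiltration f w).ideal (w' i)) (α : Fin c' →₀ ℕ) :
    (α.prod fun i e => f' i ^ e) ∈ (weightedFiltration f w).ideal (Finsupp.weight w' α) := by
  classical
  induction α using Finsupp.induction with
  | zero =>
    rw [Finsupp.prod_zero_index, map_zero, (weightedFiltration f w).ideal_zero]
    trivial
  | single_add i k α hi hk ih =>
    rw [prod_pow_add, map_add, Finsupp.weight_single, smul_eq_mul,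
      Finsupp.prod_single_index (h := fun i e => f' i ^ e) (pow_zero _)]
    have hpow : ∀ l : ℕ, f' i ^ l ∈ (weightedFiltration f w).ideal (l * w' i) := by
      intro l
      induction l with
      | zero => rw [zero_mul, (weightedFiltration f w).ideal_zero]; trivial
      | succ l ihl =>
        have := (weightedFiltration f w).mul_le _ _ (Ideal.mul_mem_mul ihl (hmem i))
        rwa [← pow_succ, show l * w' i + w' i = (l + 1) * w' i by ring] at this
    exact (weightedFiltration f w).mul_le _ _ (Ideal.mul_mem_mul (hpow k) ih)

/-- ★ **Membership of the frame bounds the filtration**: `f' i ∈ 𝒥_{w' i}(f, w)` for all `i` ⇒ `𝒥ₙ(f', w') ≤ 𝒥ₙ(f, w)` for all `n`. [OURS · L1 W4.5c] -/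
theorem weightedFiltration_le_of_mem {c c' : ℕ} (f : Fin c → B) (w : Fin c → ℕ) (f' : Fin c' → B) (w' : Fin c' → ℕ)
    (hmem : ∀ i, f' i ∈ (weightedFiltration f w).ideal (w' i)) (n : ℕ) :
    (weightedFiltration f' w').ideal n ≤ (weightedFiltration f w).ideal n := by
  rw [weightedFiltration_ideal f' w', Ideal.span_le]
  rintro _ ⟨α, hα, rfl⟩
  exact (weightedFiltration f w).antitone hα (prod_pow_mem_weightedFiltration f w f' w' hmem α)

/-- ★★ **MUTUAL MEMBERSHIP ⇒ AGREEMENT** (any two weighted frames, any lengths, any weights): if each `f' i ∈ 𝒥_{w' i}(f, w)` and each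
`f i ∈ 𝒥_{w i}(f', w')` then the two weighted filtrations coincide. This reduces the agreement clause of `KillAgreeReach` /
`exists_isPrincipalCentre_touch_of_certCover` to finitely many ring memberships. [OURS · L1 W4.5c; NOT a statement of the manuscript] -/
theorem weightedFiltration_eq_of_mem_of_mem {c c' : ℕ} (f : Fin c → B) (w : Fin c → ℕ) (f' : Fin c' → B) (w' : Fin c' → ℕ)
    (hmem : ∀ i, f' i ∈ (weightedFiltration f w).ideal (w' i)) (hmem' : ∀ i, f i ∈ (weightedFiltration f' w').ideal (w i)) (n : ℕ) :
    (weightedFiltration f w).ideal n = (weightedFiltration f' w').ideal n :=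
  le_antisymm (weightedFiltration_le_of_mem f' w' f w hmem' n) (weightedFiltration_le_of_mem f w f' w' hmem n)

/-- **The leaf agreement through mutual membership** (re-derivation of `weightedFiltration_eq_of_leaf`): for two (2,1) leaf frames with the same
centre ideal and boundary, `x₁' ∈ 𝒥₂(f)` by `mem_weightedFiltration_two_iff_of_leaf` (its increment lies in `β 𝒥₃(f') ⊆ β I²`), `x₃' ∈ I = 𝒥₁(f)`, and
symmetrically. [OURS · L1 W4.5c] -/
theorem weightedFiltration_eq_of_leaf' (σ : B ≃+* B) (β : B) (f f' : Fin 2 → B) (h h' : B) (hβ : IsSMulRegular B β)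
    (hh : IsUnit h) (hh' : IsUnit h')
    (hf0 : IsSMulRegular B (f 0)) (hf1 : ∀ t : B, f 1 * t ∈ Ideal.span {f 0} → t ∈ Ideal.span {f 0})
    (hf0' : IsSMulRegular B (f' 0)) (hf1' : ∀ t : B, f' 1 * t ∈ Ideal.span {f' 0} → t ∈ Ideal.span {f' 0})
    (hI : Ideal.span (Set.range f') = Ideal.span (Set.range f))
    (hadm0 : ∀ c : B, σ c - c ∈ Ideal.span {β} * Ideal.span (Set.range f))
    (c₁ : σ (f 0) - f 0 ∈ Ideal.span {β} * (weightedFiltration f ![2, 1]).ideal 3)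
    (c₃ : σ (f 1) - f 1 - β * h * f 0 ∈ Ideal.span {β} * (weightedFiltration f ![2, 1]).ideal 3)
    (c₁' : σ (f' 0) - f' 0 ∈ Ideal.span {β} * (weightedFiltration f' ![2, 1]).ideal 3)
    (c₃' : σ (f' 1) - f' 1 - β * h' * f' 0 ∈ Ideal.span {β} * (weightedFiltration f' ![2, 1]).ideal 3) (n : ℕ) :
    (weightedFiltration f ![2, 1]).ideal n = (weightedFiltration f' ![2, 1]).ideal n := by
  -- the heavy coordinate of each frame lies in `𝒥₂` of the other
  have key : ∀ (g g' : Fin 2 → B), IsSMulRegular B (g 0) → (∀ t : B, g 1 * t ∈ Ideal.span {g 0} → t ∈ Ideal.span {g 0}) →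
      ∀ (u : B), IsUnit u → Ideal.span (Set.range g') = Ideal.span (Set.range g) →
      (∀ c : B, σ c - c ∈ Ideal.span {β} * Ideal.span (Set.range g)) →
      σ (g 0) - g 0 ∈ Ideal.span {β} * (weightedFiltration g ![2, 1]).ideal 3 →
      σ (g 1) - g 1 - β * u * g 0 ∈ Ideal.span {β} * (weightedFiltration g ![2, 1]).ideal 3 →
      σ (g' 0) - g' 0 ∈ Ideal.span {β} * (weightedFiltration g' ![2, 1]).ideal 3 →
      ∀ i, g' i ∈ (weightedFiltration g ![2, 1]).ideal ((![2, 1] : Fin 2 → ℕ) i) := by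
    intro g g' hg0 hg1 u hu hIg hadm d₁ d₃ d₁'
    have hrange : ∀ j, g' j ∈ Ideal.span (Set.range g) := fun j => by
      rw [← hIg]; exact Ideal.subset_span ⟨j, rfl⟩
    -- `x₁' ∈ 𝒥₂(g)`: its increment lies in `β 𝒥₃(g') ⊆ β I²`
    have m0 : g' 0 ∈ (weightedFiltration g ![2, 1]).ideal 2 := by
      refine (mem_weightedFiltration_two_iff_of_leaf σ β g u hβ hu hg0 hg1 hadm d₁ d₃ (g' 0)).mpr ⟨hrange 0, ?_⟩
      have h3 : (weightedFiltration g' ![2, 1]).ideal 3 ≤ Ideal.span (Set.range g) ^ 2 := by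
        rw [← hIg]; exact weightedFiltration_three_le_sq g'
      exact Ideal.mul_mono_right h3 d₁'
    have m1 : g' 1 ∈ (weightedFiltration g ![2, 1]).ideal 1 := by
      rw [weightedFiltration_one]
      exact hrange 1
    intro i
    fin_cases i
    exacts [m0, m1]
  refine weightedFiltration_eq_of_mem_of_mem f ![2, 1] f' ![2, 1]
    (key f f' hf0 hf1 h hh hI hadm0 c₁ c₃ c₁')
    (key f' f hf0' hf1' h' hh' hI.symm (fun c => by rw [hI]; exact hadm0 c) c₁' c₃' c₁) n

end Summit.ResolutionOfSingularities.ResolutionOfSingularities.Theorems.WildQuotientResolution.S1.KillCert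

end
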